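import Summits.QuantumFields.BalabanUV.T4Continuum.Support.NE9Lemma1Gain
import Summits.QuantumFields.BalabanUV.T4Continuum.Support.NE9Lemma1RemainderPiece

/-!
# NE9PieceBoundOnClass — leaf S5 of the NE9 frame for the (1.23)/(1.33)-PIECE FORM from a CLASS-RELATIVE per-piece bound
# (`∀ H ∈ Adm`, the quantifier S5 itself carries), and a kernel witness that the per-creation-step gain of the displayed
# species needs the analytic class (cell `pub-balaban`, T4-DAG §2 node U3 / §6 NE9; NE9 formalisation swarm, unit
# `b2b-balaban-t4-ne9-formalise-leaf-10` gen 4; own-initiative micro-item «S5-ON», CLAIMS.log l.8270; companion of the row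
# owner's `NE9Lemma1Counting` / `NE9Lemma1Gain` / `NE9Lemma1RemainderPiece`, lineage t4-ne9-p1 gen 23)

HONEST FRAMING (T4-DAG PAGE 1).  Rung (B)+1 of the FINITE-VOLUME T⁴ programme — existence AND uniqueness of the ε → 0 limit
of gauge-invariant observables on a fixed torus; NOT infinite volume, NOT a mass gap, NOT the Clay problem.  NE9
(`T4OutputRate.NE9` ∧ `FadingMemory`) is a cell NEW ESTIMATE, NOT PRINTED, and is NOT discharged here («NE9 ⇐ the named
binders»); spine 0/9; 0/18 skeleton leaves instantiated on Bałaban's objects (O-NE9-1).  HONEST DEPENDENCY (cell line,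
verbatim): continuum YM on T⁴ ⇐ BetaPertH ∧ nine spine estimates (0/9 proved); BetaPertH ⇐ (D1) ∧ (D4) ∧ CAP+tail; G-an2-4
gates asym, D1 and NE2/3/4.  `FlowStep.BetaPertH`, (B), (B^μ) do not occur in this module.  [I] = [Balaban1987RG1] (CMP
**109**), [II] = [Balaban1988RG2Cluster] (CMP **116**) are quoted for TYPES only (ABSOLUTE RULE: nothing printed in the
audited series is asserted).

WHERE THIS SITS (skeleton `t4/b2b-balaban-t4-ne9-p1/SKELETON-NE9-P1.md` v1.3.4 §3 row S5, «KERNEL AT FORM LEVEL modulo ONE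
displayed per-piece bound + O1»).  The owner's `NE9Lemma1Counting.channelSizeAtStepNN_piece` /
`NE9Lemma1Gain.channelSizeAtStepNN_pieceG` derive the frame's per-creation-step size binder
`T4HistoryLipschitzRecursion.ChannelSizeAtStepNN Adm (pieceChannel P) κ wt τ` — on ANY class `Adm` — from the displayed
per-piece bound `PieceBound(G)`, which quantifies over ALL background functions `f : Bg → ℝ` with `|f U| ≤ e^{−κd(X)}·N`
(tree: `NE9Lemma1Counting` l.217–221, `NE9Lemma1Gain` l.138–142), i.e. it bounds the piece functional's OPERATOR NORM on
bounded inputs by `Kp·gain k j·(…)`.  The DISPLAYED species' producer `NE9Lemma1RemainderPiece.norm_dirRem_le` /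
`norm_remPiece_le` (owner gen 23 part 5) obtains the gain `(a/R)ⁿ` ↔ `((α₁/α₃)L^jη)⁵` from ANALYTICITY of the old term on the
complex ball (`hH : DifferentiableOn ℂ H (ball 0 R)`, iterated Schwarz) — [I] (3.54) p. 280 bounds the fifth-order
remainder through a Cauchy integral over `|σ| = r`, for 𝐄^{(j)} analytic on the spaces of Lemma 4 (3.53) p. 280 (*"The
functions in (3.53) are analytic on the above spaces."*, render `…-p032-x2.png` re-read as an image by this seat); and the
frame's S5 binder itself reads `∀ H ∈ Adm` (tree `T4HistoryLipschitzRecursion` l.1150).  THIS FILE records the consequence for the socket: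
* §1 `PieceBoundOn P Adm κ κ₁ d₀ Kp gain` — the per-piece (1.24)×(1.25) bound asked ONLY for the slices `U ↦ H U X` of
  families `H ∈ Adm` supported at the creation step (exactly the inputs `ChannelSizeAtStepNN` feeds the channel); the
  class-free `PieceBoundG` / `PieceBound` imply it on every class (`pieceBoundOn_of_pieceBoundG`, `…_of_pieceBound`), and it is
  antitone in the class (`pieceBoundOn_mono`);
* §2 **`channelSizeAtStepNN_pieceOn`**: `ChannelSizeAtStepNN Adm (pieceChannel P) κ (weightOf P κ₁ d₀ O1 Kp) (tauOfG c_Q ℓ)`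
  from `SrcScale P`, `PieceBoundOn P Adm …`, `LevelCountsG …` — the owner's proof verbatim (`levels_boundG`,
  `pieceChannel_of_supported` BY NAME), conclusion token-identical to `channelSizeAtStepNN_pieceG`'s; the profile package
  `channelSizeAtStepNN_pieceOn_profile` (END-B's `hstep`/`hτ`/`hω`/`hτbar` shapes with `τ̄ = c_Q`, ratio `ω`); the owner's
  class-free theorem RE-DERIVED through §1 (an `example`, consistency);
* §3 WHY THE CLASS (kernel, on the owner's `dirRem` BY NAME): the bounded NON-analytic input `pointMass A c` (value `c` at the
  direction `A ≠ 0`, `0` elsewhere) has `dirRem (pointMass A c) n A = c` for EVERY order `n` — all divided slopes of its slice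
  vanish at `0`, so the order-n remainder at `τ = 1` is the full value: NO `(a/R)ⁿ` gain (`dirRem_pointMass`,
  `exists_bounded_dirRem_norm_eq`), hence **`not_dirRem_gain_on_bounded`**: for `M > 0` and `2ⁿ(a/R)ⁿ < 1` the conclusion of
  `norm_dirRem_le` FAILS on the class of all inputs bounded by `M` — its analyticity hypothesis is load-bearing.  So a
  per-piece SIZE bound carrying the gain `ℓ⁵` / `gain k j` cannot be met by a remainder-type piece on all bounded inputs;
  the instance of S5 on Bałaban's (1.23) pieces (O-NE9-2, gated on O-NE9-1; on the marginal-free / projected dictionary per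
  O-ne9p1g22-1) plugs into §1's class-relative socket with `Adm` ⊆ the analytic admissible families of S2 ([II] p. 7 *"From
  the results of Sect. I.3 it follows that the term (1.23) is an analytic function of configurations 𝐔, 𝐉"*, *"All terms
  (1.23) with the localization domain Y are defined and analytic on this space."* — TYPE; render `…-p007-x2.png` re-read
  as an image by this seat).
* §4 (v1.1, APPEND-ONLY) HOSTING — re the second half of the owner's F-ne9p1g24-1 (CLAIMS.log l.8319, *"`(Bg → ℝ) →+ ℝ` …
  cannot host a contour-integral/Taylor-remainder functional"*): it CAN, non-canonically — an ℝ-linear partial piece on a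
  subspace of `Bg → ℝ` extends to a total `→+` piece agreeing with it there (Mathlib `LinearMap.exists_extend`; `hostPiece`,
  `hostPiece_apply_of_mem`); what the `→+` form cannot carry is only the class-FREE bound (§3).
RELATION TO THE OWNER's `NE9Lemma1PieceClass` p212277 (t4-ne9-p1 gen 24, GAPS O-ne9p1g24-1 — the SAME located correction,
found independently, landed within a minute of this file's v1; CLAIMS.log l.8270/l.8319/l.8462): THAT module is the class-relative
S5 socket OF RECORD (re-typed `CPieceData`, `PieceBoundOnG Adm`, `channelSizeAtStepNN_cpieceG`, `sBinders_cpieceG`); §1–§2 HERE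
are the same correction on g23's `→+` form (covered there by `toC` + `pieceBoundOnG_toC_of_pieceBoundG` up to this file's support
clause and source-only size hypothesis); §3 HERE is an INDEPENDENT witness at the REMAINDER level (theirs, §4 there: an
evaluation-difference PIECE); new consumers should socket on `NE9Lemma1PieceClass`.
NOT DONE HERE (the owner's named next items, CLAIMS.log l.8080): the (1.25)/G1 composition for `remPiece`; an additive
`PieceData` instance built on `remPiece` under a continuity hypothesis.  No END face is re-wired; leaf-03-g3's END-B at the
piece form (`NE9PieceCouplingModulus.ne9_and_fadingMemory_of_couplingTwoPoint_pieceForm`, A3 already family-relative there)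
takes §2's `hstep` in place of the class-free one by the same positional feed.  DISGUISE TEST: one input family, one history,
a size bound and its socket — the fading SOURCE, not NE9 (`T4HistoryLipschitzWitness`).

References (TYPES only): T. Bałaban, *Renormalization group approach to lattice gauge field theories. II. Cluster
expansions*, Commun. Math. Phys. **116** (1988) 1–22 [Balaban1988RG2Cluster], p. 7 ((1.23)–(1.25), *"defined and analytic on
this space"*), p. 8 ((1.26)–(1.29)), Lemma 1 (1.33)–(1.36) p. 9; T. Bałaban, *Renormalization group approach to lattice gauge
field theories. I*, Commun. Math. Phys. **109** (1987) 249–301 [Balaban1987RG1], Lemma 4 (3.53) and (3.54) p. 280; (0.29) p. 258 only through the owner's located finding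
O-ne9p1g23-1.  Summits-side NEW work (LEAN PLACEMENT RULE); imports the owner's `NE9Lemma1Gain` (+ `NE9Lemma1Counting`) and
`NE9Lemma1RemainderPiece` BY NAME; modifies nothing; 0 sorry.  Value = the honest S5 socket for the instance + a located
kernel reason, NOT summit progress.
-/

noncomputable section

namespace Summit.QuantumFields.BalabanUV.T4Continuum.NE9PieceBoundOnClass

open scoped BigOperators
open Literature.MathematicalPhysics.QuantumFieldTheory.Balaban1983to89
open Literature.MathematicalPhysics.QuantumFieldTheory.Balaban1983to89.T4OutputRate
open Literature.MathematicalPhysics.QuantumFieldTheory.Balaban1983to89.T4HistoryLipschitzRecursion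
open Summit.QuantumFields.BalabanUV.T4Continuum.NE9Lemma1Counting
open Summit.QuantumFields.BalabanUV.T4Continuum.NE9Lemma1Gain

/-! ## §1 The CLASS-RELATIVE per-piece bound -/

section Socket

variable {C : Carriers} {Bg ι α β γ : Type}

/-- **THE DISPLAYED PER-PIECE BOUND (1.24)×(1.25), CLASS-RELATIVE** (hypothesis SHAPE one level upstream of leaf S5 — the
pattern of the owner's `PieceBoundG`, referee DV-9 / owner ruling l.8080 (2); PROOF-INTERIOR of [I] §§3–5, NOT a printed
statement, NOT proved here, asserted nowhere): at step `k`, output `y`, box □₀ = `a`, domain Y₀ = `b`, creation step `j`,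
source X = `x`, for every family `H` OF THE CLASS `Adm` supported at the creation step `j` whose slice at `x` has size
`|H U x| ≤ e^{−κd(x)}·N` (`N ≥ 0`), the piece applied to that slice is bounded by
`Kp k y·N·gain k j·e^{−κd(x)}·exp(−⅛(κ₁−1)d_k(Y) + ⅛κ₁d₀ − ½(κ₁−1)·vol)` — (1.24) p. 7 *"|(1.23)| ≦ 8B₀C₁e^{16κ₁}α₂⁻¹g_k|B|E₀
(α₁/α₃)⁵(L^jη)⁵·exp(−(κ₁−1)M⁻⁴|Y₀∖□̃⁴|)exp(−κd_j(X))"* with (1.25), the gain for inputs that are analytic in the configuration (p. 7: *"the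
term (1.23) is an analytic function of configurations 𝐔, 𝐉"*; (I.3.54) p. 280 bounds the
remainder by a Cauchy integral for 𝐄^{(j)} analytic on the spaces of (I.3.53)).  The class-free `PieceBoundG` is the case `Adm = univ` without the support clause (`pieceBoundOn_of_pieceBoundG`).
CAVEAT (GAPS O-ne9p1g22-1): false for the bare curly bracket of a marginal input; and (§3) false on merely bounded inputs
for a remainder-type piece — the class is load-bearing. [cite: Balaban1988RG2Cluster, (1.24)-(1.25) p.7] -/
def PieceBoundOn (P : PieceData C Bg ι α β γ) (Adm : Set (Bg → C.Dom → ℝ)) (κ κ₁ d0 : ℝ) (Kp : ℕ → ι → ℝ)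
    (gain : ℕ → ℕ → ℝ) : Prop :=
  ∀ (k : ℕ) (s : ℕ → ℝ) (y : ι), ∀ a ∈ P.S0 k y, ∀ b ∈ P.SY k y a, ∀ (j : ℕ), ∀ x ∈ P.src k y a j,
    ∀ H ∈ Adm, (∀ (U : Bg) (X : C.Dom), C.scale X ≠ j → H U X = 0) →
      ∀ N : ℝ, 0 ≤ N → (∀ U : Bg, |H U x| ≤ Real.exp (-(κ * C.d x)) * N) →
        |P.piece k s y a b x (fun U => H U x)| ≤ Kp k y * N * gain k j * Real.exp (-(κ * C.d x)) *
          Real.exp (-(1 / 8) * (κ₁ - 1) * P.dY k y + (1 / 8) * κ₁ * d0 - (1 / 2) * (κ₁ - 1) * P.vol k y a b)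

/-- The class-free bound implies the class-relative one on EVERY class (it is the special case "all bounded slices").
[folklore] -/
theorem pieceBoundOn_of_pieceBoundG {P : PieceData C Bg ι α β γ} {κ κ₁ d0 : ℝ} {Kp : ℕ → ι → ℝ} {gain : ℕ → ℕ → ℝ}
    (h : PieceBoundG P κ κ₁ d0 Kp gain) (Adm : Set (Bg → C.Dom → ℝ)) : PieceBoundOn P Adm κ κ₁ d0 Kp gain :=
  fun k s y a ha b hb j x hx H _ _ N hN hbd => h k s y a ha b hb j x hx (fun U => H U x) N hN hbd

/-- The ℓ⁵-instance: `PieceBound P κ κ₁ d₀ Kp ℓ` implies the class-relative bound with `gain = ℓ⁵` on every class.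
[folklore] -/
theorem pieceBoundOn_of_pieceBound {P : PieceData C Bg ι α β γ} {κ κ₁ d0 : ℝ} {Kp : ℕ → ι → ℝ} {ℓ : ℕ → ℕ → ℝ}
    (h : PieceBound P κ κ₁ d0 Kp ℓ) (Adm : Set (Bg → C.Dom → ℝ)) :
    PieceBoundOn P Adm κ κ₁ d0 Kp (fun k j => ℓ k j ^ 5) :=
  pieceBoundOn_of_pieceBoundG (pieceBoundG_of_pieceBound h) Adm

/-- The class-relative bound is ANTITONE in the class: a bound on `Adm` restricts to every `Adm′ ⊆ Adm`. [folklore] -/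
theorem pieceBoundOn_mono {P : PieceData C Bg ι α β γ} {Adm Adm' : Set (Bg → C.Dom → ℝ)} {κ κ₁ d0 : ℝ}
    {Kp : ℕ → ι → ℝ} {gain : ℕ → ℕ → ℝ} (hsub : Adm' ⊆ Adm) (h : PieceBoundOn P Adm κ κ₁ d0 Kp gain) :
    PieceBoundOn P Adm' κ κ₁ d0 Kp gain :=
  fun k s y a ha b hb j x hx H hH hsupp N hN hbd => h k s y a ha b hb j x hx H (hsub hH) hsupp N hN hbd

/-! ## §2 Leaf S5 from the class-relative bound -/

/-- The step-j block of a family `H ∈ Adm` supported at the creation step `j` with size `N·e^{−κd}` there is bounded by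
`weightOf · (tauOfG · N)` — the owner's `levels_boundG` applied to the absolute values of the pieces, fed by the
class-relative bound at the slices of `H` (the source discipline `SrcScale` puts every source at scale `j`). [folklore] -/
theorem abs_stepBlock_le_on {P : PieceData C Bg ι α β γ} {Adm : Set (Bg → C.Dom → ℝ)} {κ κ₁ d0 O1 cQ : ℝ}
    {Kp : ℕ → ι → ℝ} {gain ℓ : ℕ → ℕ → ℝ} (hsrc : SrcScale P) (hPiece : PieceBoundOn P Adm κ κ₁ d0 Kp gain)
    (hL : LevelCountsG P κ κ₁ O1 cQ gain ℓ) (hKp : ∀ k y, 0 ≤ Kp k y) (hO1 : 0 ≤ O1) (hgain : ∀ k j, 0 ≤ gain k j)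
    (hcQℓ : ∀ k j, 0 ≤ cQ * ℓ k j) (k j : ℕ) (s : ℕ → ℝ) (y : ι) {H : Bg → C.Dom → ℝ} (hH : H ∈ Adm)
    (hsupp : ∀ (U : Bg) (X : C.Dom), C.scale X ≠ j → H U X = 0) {N : ℝ} (hN : 0 ≤ N)
    (hbd : ∀ (U : Bg) (X : C.Dom), C.scale X = j → |H U X| ≤ Real.exp (-(κ * C.d X)) * N) :
    |stepBlock P k s H y j| ≤ weightOf P κ₁ d0 O1 Kp k y * (tauOfG cQ ℓ k j * N) := by
  have h1 : |stepBlock P k s H y j| ≤ ∑ a ∈ P.S0 k y, ∑ b ∈ P.SY k y a,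
      ∑ x ∈ P.src k y a j, |P.piece k s y a b x (fun U => H U x)| := by
    simp only [stepBlock]
    refine (Finset.abs_sum_le_sum_abs _ _).trans (Finset.sum_le_sum fun a _ => ?_)
    refine (Finset.abs_sum_le_sum_abs _ _).trans (Finset.sum_le_sum fun b _ => ?_)
    exact Finset.abs_sum_le_sum_abs _ _
  have h2 := levels_boundG P hL (mul_nonneg (hKp k y) hN) hO1 hgain hcQℓ k y j
    (fun a b x => |P.piece k s y a b x (fun U => H U x)|) (fun a _ b _ x _ => abs_nonneg _)
    (fun a ha b hb x hx =>
      hPiece k s y a ha b hb j x hx H hH hsupp N hN (fun U => hbd U x (hsrc k y a j x hx)))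
  calc |stepBlock P k s H y j| ≤ _ := h1
    _ ≤ Kp k y * N * O1 * (cQ * ℓ k j) * Real.exp 1 * Real.exp ((1 / 8) * κ₁ * d0) *
          Real.exp (-(1 / 16) * κ₁ * P.dY k y) := h2
    _ = weightOf P κ₁ d0 O1 Kp k y * (tauOfG cQ ℓ k j * N) := by
        simp only [weightOf, tauOfG]; ring

/-- **LEAF S5 FOR THE PIECE FORM FROM THE CLASS-RELATIVE BOUND (the point of the module)**: a channel of the printed
(1.23)/(1.33)-piece form whose pieces obey the displayed (1.24)×(1.25) bound ON THE SLICES OF THE CLASS `Adm` and whose index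
families obey the level counts of [II] p. 8 satisfies `ChannelSizeAtStepNN Adm (pieceChannel P) κ wt τ` ON THAT CLASS, with
`wt = weightOf P κ₁ d₀ O1 Kp` and `τ k j = c_Q·ℓ k j` — conclusion token-identical to the owner's
`NE9Lemma1Gain.channelSizeAtStepNN_pieceG`, hypothesis `PieceBoundG` WEAKENED to `PieceBoundOn P Adm`.  One input family,
one history: the fading SOURCE, not NE9. [cite: Balaban1988RG2Cluster, (1.24)-(1.29) pp.7-8, (1.36) p.9] -/
theorem channelSizeAtStepNN_pieceOn {P : PieceData C Bg ι α β γ} {Adm : Set (Bg → C.Dom → ℝ)} {κ κ₁ d0 O1 cQ : ℝ}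
    {Kp : ℕ → ι → ℝ} {gain ℓ : ℕ → ℕ → ℝ} (hsrc : SrcScale P) (hPiece : PieceBoundOn P Adm κ κ₁ d0 Kp gain)
    (hL : LevelCountsG P κ κ₁ O1 cQ gain ℓ) (hKp : ∀ k y, 0 ≤ Kp k y) (hO1 : 0 ≤ O1) (hgain : ∀ k j, 0 ≤ gain k j)
    (hcQℓ : ∀ k j, 0 ≤ cQ * ℓ k j) :
    ChannelSizeAtStepNN Adm (pieceChannel P) κ (weightOf P κ₁ d0 O1 Kp) (tauOfG cQ ℓ) := by
  intro k j hjk s H hH hsupp N hN hbd y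
  rw [pieceChannel_of_supported hsrc hjk s hsupp y]
  exact abs_stepBlock_le_on hsrc hPiece hL hKp hO1 hgain hcQℓ k j s y hH hsupp hN hbd

/-- CONSISTENCY (an `example`, not a declaration — the statement IS the owner's `NE9Lemma1Gain.channelSizeAtStepNN_pieceG`):
the class-free leaf RE-DERIVED through the class-relative socket (`pieceBoundOn_of_pieceBoundG` then
`channelSizeAtStepNN_pieceOn`). [folklore] -/
example {P : PieceData C Bg ι α β γ} {κ κ₁ d0 O1 cQ : ℝ} {Kp : ℕ → ι → ℝ}
    {gain ℓ : ℕ → ℕ → ℝ} (hsrc : SrcScale P) (hPiece : PieceBoundG P κ κ₁ d0 Kp gain)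
    (hL : LevelCountsG P κ κ₁ O1 cQ gain ℓ) (hKp : ∀ k y, 0 ≤ Kp k y) (hO1 : 0 ≤ O1) (hgain : ∀ k j, 0 ≤ gain k j)
    (hcQℓ : ∀ k j, 0 ≤ cQ * ℓ k j) (Adm : Set (Bg → C.Dom → ℝ)) :
    ChannelSizeAtStepNN Adm (pieceChannel P) κ (weightOf P κ₁ d0 O1 Kp) (tauOfG cQ ℓ) :=
  channelSizeAtStepNN_pieceOn hsrc (pieceBoundOn_of_pieceBoundG hPiece Adm) hL hKp hO1 hgain hcQℓ

/-- The ℓ⁵ / (6L)⁴ instance of the class-relative leaf: with `gain = ℓ⁵`, `c_Q = (6L)⁴` the profile is the owner's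
`tauOf L ℓ` (`NE9Lemma1Gain.tauOf_eq_tauOfG`). [folklore] -/
theorem channelSizeAtStepNN_pieceOn_ell5 {P : PieceData C Bg ι α β γ} {Adm : Set (Bg → C.Dom → ℝ)} {κ κ₁ d0 O1 L : ℝ}
    {Kp : ℕ → ι → ℝ} {ℓ : ℕ → ℕ → ℝ} (hsrc : SrcScale P)
    (hPiece : PieceBoundOn P Adm κ κ₁ d0 Kp (fun k j => ℓ k j ^ 5)) (hL : LevelCounts P κ κ₁ O1 L ℓ)
    (hKp : ∀ k y, 0 ≤ Kp k y) (hO1 : 0 ≤ O1) (hℓ : ∀ k j, 0 ≤ ℓ k j) :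
    ChannelSizeAtStepNN Adm (pieceChannel P) κ (weightOf P κ₁ d0 O1 Kp) (tauOf L ℓ) := by
  rw [tauOf_eq_tauOfG]
  exact channelSizeAtStepNN_pieceOn hsrc hPiece (levelCountsG_of_levelCounts hL) hKp hO1
    (fun k j => pow_nonneg (hℓ k j) 5) (fun k j => mul_nonneg (by positivity) (hℓ k j))

/-- **THE S5 SIDE OF THE END, CLASS-RELATIVE, PACKAGED**: the size binder `hstep` on `Adm` with the α-profile
`τ k j = c_Q·ω^{k−j}` (level count asked as `card(□′)·gain k j ≤ c_Q·ω^{k−j}`), together with the END's profile binders in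
their literal shapes — `hτ : ∀ k j, j ≤ k → 0 ≤ τ k j ∧ τ k j ≤ τ̄·ω^{k−j}` with `τ̄ = c_Q`, `hω : 0 ≤ ω`, `hτbar : 0 ≤ c_Q`
(instantiate `ω := L^{−α}` with `NE9Lemma1Gain.rpow_neg_pos_lt_one`, α the exponent of [I] (0.29) per O-ne9p1g23-1).
[cite: Balaban1988RG2Cluster, (1.36) p.9] -/
theorem channelSizeAtStepNN_pieceOn_profile {P : PieceData C Bg ι α β γ} {Adm : Set (Bg → C.Dom → ℝ)}
    {κ κ₁ d0 O1 cQ ω : ℝ} {Kp : ℕ → ι → ℝ} {gain : ℕ → ℕ → ℝ} (hsrc : SrcScale P)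
    (hPiece : PieceBoundOn P Adm κ κ₁ d0 Kp gain) (hL : LevelCountsG P κ κ₁ O1 cQ gain (agePow ω))
    (hKp : ∀ k y, 0 ≤ Kp k y) (hO1 : 0 ≤ O1) (hgain : ∀ k j, 0 ≤ gain k j) (hcQ : 0 ≤ cQ) (hω : 0 ≤ ω) :
    ChannelSizeAtStepNN Adm (pieceChannel P) κ (weightOf P κ₁ d0 O1 Kp) (tauOfG cQ (agePow ω)) ∧
      (∀ k j : ℕ, j ≤ k → 0 ≤ tauOfG cQ (agePow ω) k j ∧ tauOfG cQ (agePow ω) k j ≤ cQ * ω ^ (k - j)) ∧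
        0 ≤ ω ∧ 0 ≤ cQ := by
  refine ⟨channelSizeAtStepNN_pieceOn hsrc hPiece hL hKp hO1 hgain
    (fun k j => mul_nonneg hcQ (agePow_nonneg hω k j)), fun k j _ => ⟨?_, (tauOfG_agePow cQ ω k j).le⟩, hω, hcQ⟩
  exact mul_nonneg hcQ (agePow_nonneg hω k j)

end Socket

/-! ## §3 WHY THE CLASS: no per-creation-step gain on merely bounded inputs (kernel witness on the owner's `dirRem`) -/

section Witness

open Summit.QuantumFields.BalabanUV.T4Continuum.NE9Lemma1RemainderPiece
open Literature.MathematicalPhysics.QuantumFieldTheory.Balaban1983to89.B11SchwarzRemainder (tail tail_zero tail_succ)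

variable {F : Type*} [NormedAddCommGroup F] [NormedSpace ℂ F]

/-- The slice witness: the indicator of `{1}` with value `c` (zero in a neighbourhood of the expansion point `0`).
[folklore] -/
def indicatorOne (c : F) : ℂ → F := fun τ => if τ = 1 then c else 0

omit [NormedSpace ℂ F] in
/-- `indicatorOne c` vanishes in a neighbourhood of `0`. [folklore] -/
theorem indicatorOne_eventuallyEq_zero (c : F) : indicatorOne c =ᶠ[nhds (0 : ℂ)] fun _ => (0 : F) := by
  have hopen : IsOpen {τ : ℂ | τ ≠ 1} := isOpen_ne
  have hmem : {τ : ℂ | τ ≠ 1} ∈ nhds (0 : ℂ) := hopen.mem_nhds (by simp)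
  filter_upwards [hmem] with τ hτ
  have hτ' : τ ≠ 1 := hτ
  simp only [indicatorOne, if_neg hτ']

/-- The divided slope of the slice witness at `0` is the witness itself: off `0` it is `τ⁻¹•(value − 0)`, non-zero only at
`τ = 1` where `τ⁻¹ = 1`; at `0` it is the derivative of a function vanishing near `0`. [folklore] -/
theorem dslope_indicatorOne (c : F) : dslope (indicatorOne c) 0 = indicatorOne c := by
  funext t
  by_cases ht : t = 0
  · subst ht
    rw [dslope_same, (indicatorOne_eventuallyEq_zero c).deriv_eq, deriv_const]
    simp [indicatorOne]
  · rw [dslope_of_ne _ ht, slope_def_module, sub_zero]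
    have h0 : indicatorOne c 0 = 0 := by simp [indicatorOne]
    rw [h0, sub_zero]
    by_cases h1 : t = 1
    · subst h1; simp [indicatorOne]
    · simp [indicatorOne, h1]

/-- Every iterated divided slope of the slice witness at `0` is the witness itself. [folklore] -/
theorem tail_indicatorOne (c : F) (m : ℕ) : tail (indicatorOne c) m = indicatorOne c := by
  induction m with
  | zero => exact tail_zero _
  | succ m ih => rw [tail_succ, ih, dslope_indicatorOne]

/-- The order-`n` Taylor remainder of the slice witness at `τ = 1` is its FULL value `c`, for every `n` (all Newton–Taylor
coefficients at `0` vanish). [folklore] -/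
theorem taylorRem_indicatorOne (c : F) (n : ℕ) : taylorRem (indicatorOne c) n 1 = c := by
  have hhead : taylorHead (indicatorOne c) n 1 = 0 := by
    simp only [taylorHead, one_pow, one_smul, tail_indicatorOne]
    exact Finset.sum_eq_zero fun m _ => by simp [indicatorOne]
  rw [taylorRem, hhead, sub_zero]
  simp [indicatorOne]

variable {E : Type*}

open Classical in
/-- The configuration-space witness: value `c` at the direction `A`, `0` elsewhere — bounded by `‖c‖`, NOT analytic.
[folklore] -/
def pointMass (A : E) (c : F) : E → F := fun z => if z = A then c else 0

omit [NormedSpace ℂ F] in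
/-- `pointMass A c A = c`. [folklore] -/
theorem pointMass_apply_self (A : E) (c : F) : pointMass A c A = c := by
  simp [pointMass]

omit [NormedSpace ℂ F] in
/-- `pointMass A c z = 0` off the direction. [folklore] -/
theorem pointMass_apply_of_ne {A z : E} (h : z ≠ A) (c : F) : pointMass A c z = 0 := by
  simp [pointMass, h]

omit [NormedSpace ℂ F] in
/-- `‖pointMass A c z‖ ≤ ‖c‖` everywhere. [folklore] -/
theorem norm_pointMass_le (A : E) (c : F) (z : E) : ‖pointMass A c z‖ ≤ ‖c‖ := by
  by_cases h : z = A
  · rw [h, pointMass_apply_self]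
  · rw [pointMass_apply_of_ne h]; simp

variable [NormedAddCommGroup E] [NormedSpace ℂ E]

omit [NormedSpace ℂ F] in
/-- The slice of the point mass along its own direction `A ≠ 0` is the slice witness `indicatorOne c`
(`τ•A = A ↔ τ = 1`). [folklore] -/
theorem pointMass_slice {A : E} (hA : A ≠ 0) (c : F) :
    (fun τ : ℂ => pointMass A c (τ • A)) = indicatorOne c := by
  funext τ
  have hiff : τ • A = A ↔ τ = 1 := by
    constructor
    · intro h
      have h' : (τ - 1) • A = 0 := by rw [sub_smul, one_smul, h, sub_self]
      rcases smul_eq_zero.mp h' with h1 | h1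
      · exact sub_eq_zero.mp h1
      · exact absurd h1 hA
    · intro h; rw [h, one_smul]
  by_cases h1 : τ = 1
  · have hA' : τ • A = A := hiff.mpr h1
    simp only [indicatorOne, if_pos h1]
    rw [hA', pointMass_apply_self]
  · have hA' : τ • A ≠ A := fun h => h1 (hiff.mp h)
    simp only [indicatorOne, if_neg h1]
    exact pointMass_apply_of_ne hA' c

/-- **NO GAIN WITHOUT THE CLASS**: along its own direction `A ≠ 0` the order-`n` remainder of the bounded non-analytic input
`pointMass A c` is the FULL value, `dirRem (pointMass A c) n A = c`, for every order `n` — compare `norm_dirRem_le`'s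
`≤ 2ⁿ·M·(a/R)ⁿ` for analytic inputs. [folklore] -/
theorem dirRem_pointMass {A : E} (hA : A ≠ 0) (c : F) (n : ℕ) : dirRem (pointMass A c) n A = c := by
  unfold dirRem
  rw [pointMass_slice hA c]
  exact taylorRem_indicatorOne c n

/-- For every direction `A ≠ 0`, order `n` and level `M ≥ 0` there is an input bounded by `M` EVERYWHERE whose order-`n`
remainder along `A` has norm exactly `M` (complex-valued witness `pointMass A M`). [folklore] -/
theorem exists_bounded_dirRem_norm_eq {A : E} (hA : A ≠ 0) (n : ℕ) {M : ℝ} (hM : 0 ≤ M) :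
    ∃ H : E → ℂ, (∀ z, ‖H z‖ ≤ M) ∧ ‖dirRem H n A‖ = M := by
  refine ⟨pointMass A (M : ℂ), fun z => ?_, ?_⟩
  · calc ‖pointMass A (M : ℂ) z‖ ≤ ‖(M : ℂ)‖ := norm_pointMass_le A _ z
      _ = M := by rw [Complex.norm_real, Real.norm_of_nonneg hM]
  · rw [dirRem_pointMass hA, Complex.norm_real, Real.norm_of_nonneg hM]

/-- **THE ANALYTICITY HYPOTHESIS OF `norm_dirRem_le` IS LOAD-BEARING**: whenever the gain factor is a genuine gain
(`2ⁿ·(a/R)ⁿ < 1`) and `M > 0`, the remainder bound `‖dirRem H n A‖ ≤ 2ⁿ·M·(a/R)ⁿ` FAILS on the class of all inputs bounded by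
`M` (witness `pointMass A M`, any direction `A ≠ 0`).  Hence a per-piece SIZE bound carrying the per-creation-step gain
(`PieceBound`'s `ℓ⁵`, `PieceBoundG`'s `gain k j`) cannot hold over all bounded slices for a remainder-type piece: the
instance on the (1.23) pieces needs the CLASS-RELATIVE socket `PieceBoundOn` of §1 with an analytic class. [folklore] -/
theorem not_dirRem_gain_on_bounded {A : E} (hA : A ≠ 0) {a R M : ℝ} {n : ℕ} (hM : 0 < M)
    (hgain : 2 ^ n * (a / R) ^ n < 1) :
    ¬ ∀ H : E → ℂ, (∀ z, ‖H z‖ ≤ M) → ‖dirRem H n A‖ ≤ 2 ^ n * M * (a / R) ^ n := by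
  intro h
  obtain ⟨H, hHM, hnorm⟩ := exists_bounded_dirRem_norm_eq hA n hM.le
  have h1 := h H hHM
  rw [hnorm] at h1
  have h2 : 2 ^ n * M * (a / R) ^ n < M := by
    have : 2 ^ n * M * (a / R) ^ n = (2 ^ n * (a / R) ^ n) * M := by ring
    rw [this]
    calc (2 ^ n * (a / R) ^ n) * M < 1 * M := mul_lt_mul_of_pos_right hgain hM
      _ = M := one_mul M
  linarith

/-- The same at the level of the printed case `n = 5` with the letters of `norm_remPiece_five_le`: if `32·(a/R)⁵ < 1` ([I]
p. 280 *"Because |B| < O(1)L^jη, e.g. |B| < α₁L^jη"* — the field small relative to the analyticity radius) the order-5 remainder gain is absent on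
bounded non-analytic inputs. [folklore] -/
theorem not_dirRem_gain_on_bounded_five {A : E} (hA : A ≠ 0) {a R M : ℝ} (hM : 0 < M) (hgain : 32 * (a / R) ^ 5 < 1) :
    ¬ ∀ H : E → ℂ, (∀ z, ‖H z‖ ≤ M) → ‖dirRem H 5 A‖ ≤ 2 ^ 5 * M * (a / R) ^ 5 :=
  not_dirRem_gain_on_bounded hA hM (by norm_num; linarith)

end Witness

/-! ## §4 (v1.1) HOSTING: a partial LINEAR piece extends to a total `→+` piece (re F-ne9p1g24-1, CLAIMS.log l.8319/l.8522) -/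

section Hosting

variable {Bg : Type}

/-- **HOSTING A PARTIAL PIECE IN THE `→+` FORM** (plumbing; Mathlib `LinearMap.exists_extend`, Hamel-basis extension over `ℝ`):
an ℝ-linear `φ` on a SUBSPACE `p ⊆ (Bg → ℝ)` — e.g. the honest (1.23) functional on the span of the slices of the analytic /
integrable families, where additivity of the remainder and of the INTEGRABLE contour integrals holds — is the restriction of a
TOTAL `Φ : (Bg → ℝ) →+ ℝ` (a `PieceData.piece`-shaped functional); the values off `p` are a choice, never tested by the
class-relative `PieceBoundOn` of §1.  So g23's `→+` form CAN host the displayed species' functional (non-canonically); what it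
cannot carry is the class-FREE bound (§3). [folklore] -/
theorem exists_addMonoidHom_extend (p : Submodule ℝ (Bg → ℝ)) (φ : p →ₗ[ℝ] ℝ) :
    ∃ Φ : (Bg → ℝ) →+ ℝ, ∀ (f : Bg → ℝ) (hf : f ∈ p), Φ f = φ ⟨f, hf⟩ := by
  obtain ⟨g, hg⟩ := LinearMap.exists_extend φ
  refine ⟨g.toAddMonoidHom, fun f hf => ?_⟩
  have h := LinearMap.congr_fun hg ⟨f, hf⟩
  simpa using h

/-- THE HOSTED PIECE: a total additive functional on `Bg → ℝ` extending the partial linear piece `φ : p →ₗ[ℝ] ℝ` (a choice,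
`Classical.choose` of `exists_addMonoidHom_extend`). [folklore] -/
def hostPiece (p : Submodule ℝ (Bg → ℝ)) (φ : p →ₗ[ℝ] ℝ) : (Bg → ℝ) →+ ℝ :=
  Classical.choose (exists_addMonoidHom_extend p φ)

/-- The hosted piece AGREES with the partial piece on its subspace: `hostPiece p φ f = φ ⟨f, hf⟩` for `f ∈ p` — so a per-piece
bound proved for `φ` on the slices of a class `Adm` (slices in `p`) is literally `PieceBoundOn … Adm …` for a `PieceData` whose
pieces are the hosted ones. [folklore] -/
theorem hostPiece_apply_of_mem (p : Submodule ℝ (Bg → ℝ)) (φ : p →ₗ[ℝ] ℝ) {f : Bg → ℝ} (hf : f ∈ p) :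
    hostPiece p φ f = φ ⟨f, hf⟩ :=
  Classical.choose_spec (exists_addMonoidHom_extend p φ) f hf

/-- On the subspace the hosted piece is ℝ-HOMOGENEOUS (it restricts to the linear `φ`). [folklore] -/
theorem hostPiece_smul_of_mem (p : Submodule ℝ (Bg → ℝ)) (φ : p →ₗ[ℝ] ℝ) {f : Bg → ℝ} (hf : f ∈ p) (c : ℝ) :
    hostPiece p φ (c • f) = c * hostPiece p φ f := by
  rw [hostPiece_apply_of_mem p φ (p.smul_mem c hf), hostPiece_apply_of_mem p φ hf]
  have h := φ.map_smul c ⟨f, hf⟩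
  simpa using h

end Hosting

end Summit.QuantumFields.BalabanUV.T4Continuum.NE9PieceBoundOnClass
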